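import Mathlib
import HarnessLib
import Summits.KontsevichZagierPeriods.KontsevichZagierPeriods.Theses.Neg
import Literature.NumberTheory.Transcendental.KZProductIdeal
import Literature.NumberTheory.Transcendental.KZCubeProducts
import Literature.NumberTheory.Transcendental.KZDirichletScaling

/-!
# Birth skeleton of the split child `DasRootNotAccessible` (crux CancellationGap, route Neg)

`DasRootNotAccessible` is ATOMIC: every proof is an additive invariant of `KZ.FormalRep` killing the four
move sets and separating the pinned pair (template `Neg.NegObstructionShape`, item 0313, proved), and no
candidate invariant is known — it must see NON-MOTIVIC features of the rules calculus, because the class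
`a = (1,4,9,10)/12` is a Hodge (1,1) class on the Fermat surface of degree 12, algebraic by Lefschetz, so every
invariant factoring through formal motivic periods takes EQUAL values on the pair (Deligne, DMOS I §7). Two
remarks fix the shape of the one honest stub below:

* the invariant must be valued in a TORSION-FREE group: for every additive `ι : FormalRep →+ ZMod 2` killing
  integrand additivity, `ι [σ, f] = ι [σ, f/2] + ι [σ, f/2] = 0` — the Das "sign" (a `μ₂`-torsor datum) cannot be
  read by a mod-2 functional on `FormalRep`; we take `ι` real-valued;
* normalising `ι` to `1` on the Das representation and `0` on the `α`-arcsine representation is a genuine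
  STRENGTHENING of the crux (`DasRootNotAccessible → stub` would need a `ℚ`-linear extension argument through the
  torsion-freeness and divisibility of `FormalRep ⧸ relations`, absent from the tree), not a costume.

So this skeleton has ONE stub (`stub_dasSeparatingInvariant`) and the composition `DasRootNotAccessible_of`
(`AddSubgroup.closure_le`: relations ≤ ker ι, hence equivalent representations have equal `ι`). A second,
independent stub would require naming the invariant; that is the open core of the crux (see the line card).
-/

noncomputable section

namespace Summit.KontsevichZagierPeriods.KontsevichZagierPeriods.Cruxes.CancellationGap.DasRootBirth

open MeasureTheory Set
open Literature.NumberTheory.Transcendental Literature.NumberTheory.Transcendental.KZ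

/-- STUB (the separating invariant, normalised): there is a real-valued additive invariant of formal
combinations of integral representations that kills the four move sets, takes the value `1` on every
representation pinned as the Das cube-Beta representation and `0` on every representation pinned as the
`α`-arcsine representation. [folklore] -/
theorem stub_dasSeparatingInvariant :
    ∃ ι : Literature.NumberTheory.Transcendental.KZ.FormalRep →+ ℝ,
      (∀ c ∈ Literature.NumberTheory.Transcendental.KZ.domainAddRel ∪
          Literature.NumberTheory.Transcendental.KZ.integrandAddRel ∪
          Literature.NumberTheory.Transcendental.KZ.changeOfVariablesRel ∪
          Literature.NumberTheory.Transcendental.KZ.newtonLeibnizRel, ι c = 0) ∧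
      (∀ r : Literature.NumberTheory.Transcendental.KZ.IntegralRep 3,
        r.domain = {t | ∀ j, t j ∈ Set.Ioo (0:ℝ) 1} →
        Set.EqOn r.integrand (fun t => ∏ j, t j ^ (((![(1:ℚ)/12, 5/12, 7/6] : Fin 3 → ℚ) j : ℝ) - 1) *
          (1 - t j) ^ (((![(1:ℚ)/3, 3/4, 5/6] : Fin 3 → ℚ) j : ℝ) - 1)) r.domain →
        ι (Literature.NumberTheory.Transcendental.KZ.of r) = 1) ∧
      (∀ r' : Literature.NumberTheory.Transcendental.KZ.IntegralRep 3,
        r'.domain = {t | ∀ j, t j ∈ Set.Ioo (0:ℝ) 1} →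
        Set.EqOn r'.integrand (fun t => (2:ℝ) ^ ((19:ℝ)/12) * (3:ℝ) ^ (-(1:ℝ)/8) * Real.sqrt (1 + Real.sqrt 3) *
          ∏ j, t j ^ (((![(1:ℚ)/2, 1/2, 1] : Fin 3 → ℚ) j : ℝ) - 1) *
            (1 - t j) ^ (((![(1:ℚ)/2, 1/2, 1] : Fin 3 → ℚ) j : ℝ) - 1)) r'.domain →
        ι (Literature.NumberTheory.Transcendental.KZ.of r') = 0) := by
  sorry

/-- **Composition**: the split child `DasRootNotAccessible` (verbatim) from the stub — relations are generated
by the four move sets, so they lie in the kernel of `ι` (`AddSubgroup.closure_le`); an equivalence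
`[r] − [r'] ∈ relations` of a pinned pair would give `1 = ι [r] = ι [r'] = 0`. [folklore] -/
theorem DasRootNotAccessible_of :
    ¬ (∀ (r r' : Literature.NumberTheory.Transcendental.KZ.IntegralRep 3), r.domain = {t | ∀ j, t j ∈ Set.Ioo (0:ℝ) 1} → Set.EqOn r.integrand (fun t => ∏ j, t j ^ (((![(1:ℚ)/12, 5/12, 7/6] : Fin 3 → ℚ) j : ℝ) - 1) * (1 - t j) ^ (((![(1:ℚ)/3, 3/4, 5/6] : Fin 3 → ℚ) j : ℝ) - 1)) r.domain → r'.domain = {t | ∀ j, t j ∈ Set.Ioo (0:ℝ) 1} → Set.EqOn r'.integrand (fun t => (2:ℝ) ^ ((19:ℝ)/12) * (3:ℝ) ^ (-(1:ℝ)/8) * Real.sqrt (1 + Real.sqrt 3) * ∏ j, t j ^ (((![(1:ℚ)/2, 1/2, 1] : Fin 3 → ℚ) j : ℝ) - 1) * (1 - t j) ^ (((![(1:ℚ)/2, 1/2, 1] : Fin 3 → ℚ) j : ℝ) - 1)) r'.domain → Literature.NumberTheory.Transcendental.KZ.Equivalent r r') := by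
  intro hall
  obtain ⟨ι, hmoves, hr, hr'⟩ := stub_dasSeparatingInvariant
  -- pinned representatives exist (cube Beta data are positive; the arcsine one scaled by an algebraic constant
  -- is not needed: we only need ONE pinned pair, and `hall` is about all of them — so take the pair from the
  -- existence statements below)
  obtain ⟨r, hrd, hri⟩ := KZ.exists_cubeBetaRep (![(1:ℚ)/12, 5/12, 7/6] : Fin 3 → ℚ)
    (![(1:ℚ)/3, 3/4, 5/6] : Fin 3 → ℚ) (fun j => by fin_cases j <;> norm_num)
  obtain ⟨R, hRd, hRi⟩ := KZ.exists_cubeBetaRep (![(1:ℚ)/2, 1/2, 1] : Fin 3 → ℚ)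
    (![(1:ℚ)/2, 1/2, 1] : Fin 3 → ℚ) (fun j => by fin_cases j <;> norm_num)
  -- the `α`-arcsine representation: scale `R` by the real algebraic constant `α`
  have hα : IsAlgebraic ℚ ((2:ℝ) ^ ((19:ℝ)/12) * (3:ℝ) ^ (-(1:ℝ)/8) * Real.sqrt (1 + Real.sqrt 3)) := by
    have h2 := KZ.isAlgebraic_natCast_rpow_ratCast 2 (19/12)
    have h3 := KZ.isAlgebraic_natCast_rpow_ratCast 3 (-1/8)
    have e2 : ((2:ℕ) : ℝ) ^ (((19/12 : ℚ)) : ℝ) = (2:ℝ) ^ ((19:ℝ)/12) := by norm_num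
    have e3 : ((3:ℕ) : ℝ) ^ (((-1/8 : ℚ)) : ℝ) = (3:ℝ) ^ (-(1:ℝ)/8) := by norm_num
    rw [e2] at h2
    rw [e3] at h3
    -- `√3` and `√(1+√3)` are algebraic (square roots of algebraic numbers)
    have hsqrt3 : IsAlgebraic ℚ (Real.sqrt 3) :=
      IsAlgebraic.of_pow two_pos (by
        rw [Real.sq_sqrt (by norm_num : (0:ℝ) ≤ 3)]
        exact_mod_cast isAlgebraic_nat 3)
    have hs : IsAlgebraic ℚ (Real.sqrt (1 + Real.sqrt 3)) :=
      IsAlgebraic.of_pow two_pos (by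
        rw [Real.sq_sqrt (by positivity)]
        exact isAlgebraic_one.add hsqrt3)
    exact (h2.mul h3).mul hs
  let r' : IntegralRep 3 := R.constMul _ hα
  have hr'd : r'.domain = {t | ∀ j, t j ∈ Set.Ioo (0:ℝ) 1} := by
    show R.domain = _
    exact hRd
  have hr'i : Set.EqOn r'.integrand (fun t => (2:ℝ) ^ ((19:ℝ)/12) * (3:ℝ) ^ (-(1:ℝ)/8) *
      Real.sqrt (1 + Real.sqrt 3) *
        ∏ j, t j ^ (((![(1:ℚ)/2, 1/2, 1] : Fin 3 → ℚ) j : ℝ) - 1) *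
          (1 - t j) ^ (((![(1:ℚ)/2, 1/2, 1] : Fin 3 → ℚ) j : ℝ) - 1)) r'.domain := by
    intro t ht
    show (2:ℝ) ^ ((19:ℝ)/12) * (3:ℝ) ^ (-(1:ℝ)/8) * Real.sqrt (1 + Real.sqrt 3) * R.integrand t = _
    rw [hRi ht]
  have hE : Equivalent r r' := hall r r' hrd hri hr'd hr'i
  -- relations ≤ ker ι
  have hker : relations ≤ ι.ker := by
    unfold relations
    exact (AddSubgroup.closure_le _).mpr fun c hc => hmoves c hc
  have h0 : ι (of r - of r') = 0 := hker hE
  rw [map_sub, hr r hrd hri, hr' r' hr'd hr'i] at h0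
  norm_num at h0

end Summit.KontsevichZagierPeriods.KontsevichZagierPeriods.Cruxes.CancellationGap.DasRootBirth

end
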